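import Summits.CriticalPhenomena.PercolationContinuityZ3.Theorems.PercNearOneGluingNoHeavyLowerTailThresholdRABCircle
import Summits.CriticalPhenomena.PercolationContinuityZ3.Theorems.PercNearOneGluingNoHeavyLowerTailThresholdRAB
import Mathlib.Logic.Equiv.Fintype
import Mathlib.Data.Fintype.Perm
import Mathlib.Data.Fintype.Powerset

/-!
# `NoHeavyLowerTail` (crux stmt-CriticalPhenomena-4575), lane prim-ineq-gen-4 (gen 18): the half-cube lemma for intersecting
# families (averaging Katona's circle) and the unconditional fibre lemma (RAB_k) for every `k`

Support file (`--supports stmt-CriticalPhenomena-4575`; memo `run/shared/lean/prim/prim-ineq-gen-4/PROOFS-RAB-ALL-K-g18.md`).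
No definitions, no `sorry`, standard axioms.

`halfCube_univ` / `halfCube`: a lower set `F` of subsets of a `2m`-set no two members of which cover the ground set has at most as
many members of size `≥ m` as of size `< m` (equivalently: an intersecting up-set `E ⊆ 𝒫([2m])` has `#E_{≤m} ≤ #E_{>m}`; memo Lemma C).
Proof: for every bijection `φ : ZMod (2m) ≃ ground set`, the pulled-back family satisfies the arc inequality (`arc_ineq_family`);
summing over all `φ`, every `j`-subset is the image of a given arc under the same number of bijections (`card_filter_map_eq_eq`),
so the arc counts average to multiples of the level counts `#F_j`.  Consequence: the hypothesis `hC` of `rab_of_halfCube`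
(companion file `…ThresholdRAB`) is discharged — `rab_counting`, the fibre lemma (RAB_k) for all `k` in all dimensions `≥ 2k − 2`.
-/

namespace Summit.CriticalPhenomena.PercolationContinuityZ3.Theorems.ThresholdRAB

open Finset

section Averaging

variable {β : Type*} [DecidableEq β] [Fintype β] {n : ℕ} [NeZero n]

omit [NeZero n] in
/-- An arc of length `j ≤ n` has exactly `j` points. [folklore] -/
theorem card_arc (s : ZMod n) {j : ℕ} (hj : j ≤ n) : #((range j).image fun i : ℕ => s + (i : ZMod n)) = j := by
  rw [card_image_of_injOn, card_range]
  intro i hi i' hi' h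
  rw [mem_coe, mem_range] at hi hi'
  have h1 : (i : ZMod n) = (i' : ZMod n) := add_left_cancel h
  have h2 := congrArg ZMod.val h1
  rwa [ZMod.val_natCast, ZMod.val_natCast, Nat.mod_eq_of_lt (lt_of_lt_of_le hi hj),
    Nat.mod_eq_of_lt (lt_of_lt_of_le hi' hj)] at h2

/-- Uniformity (one direction): the number of bijections `φ` mapping a fixed `x` onto `z` is at most the number mapping it onto
any `z'` of the same size (compose with a permutation carrying `z` to `z'`). [this work] -/
theorem card_filter_map_eq_le (x : Finset (ZMod n)) {z z' : Finset β} (hzz' : #z = #z') :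
    #(univ.filter fun φ : ZMod n ≃ β => x.map φ.toEmbedding = z)
      ≤ #(univ.filter fun φ : ZMod n ≃ β => x.map φ.toEmbedding = z') := by
  -- a permutation of β carrying z onto z'
  let e : {b // b ∈ z} ≃ {b // b ∈ z'} := Finset.equivOfCardEq hzz'
  let π : Equiv.Perm β := e.extendSubtype
  have hπ : z.map π.toEmbedding = z' := by
    apply eq_of_subset_of_card_le
    · intro b hb
      rw [mem_map] at hb
      obtain ⟨a, ha, rfl⟩ := hb
      exact e.extendSubtype_mem a ha
    · rw [card_map, hzz']
  refine card_le_card_of_injOn (fun φ => φ.trans π) (fun φ hφ => ?_) (fun φ _ φ' _ h => ?_)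
  · rw [mem_coe, mem_filter] at hφ ⊢
    refine ⟨mem_univ _, ?_⟩
    rw [Equiv.trans_toEmbedding, ← map_map, hφ.2, hπ]
  · have := congrArg (fun ψ : ZMod n ≃ β => ψ.trans π.symm) h
    simpa [Equiv.trans_assoc] using this

/-- Uniformity: bijections mapping a fixed `x` onto `z` are as many as those mapping it onto `z'`, if `#z = #z'`. [this work] -/
theorem card_filter_map_eq_eq (x : Finset (ZMod n)) {z z' : Finset β} (hzz' : #z = #z') :
    #(univ.filter fun φ : ZMod n ≃ β => x.map φ.toEmbedding = z)
      = #(univ.filter fun φ : ZMod n ≃ β => x.map φ.toEmbedding = z') :=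
  le_antisymm (card_filter_map_eq_le x hzz') (card_filter_map_eq_le x hzz'.symm)

/-- Fibre count: `C(#β, #x) · #{φ : x ↦ z} = #(ZMod n ≃ β)` for every `z` with `#z = #x`. [this work] -/
theorem choose_mul_card_filter_map_eq (x : Finset (ZMod n)) (z : Finset β) (hz : #z = #x) :
    (Fintype.card β).choose #x * #(univ.filter fun φ : ZMod n ≃ β => x.map φ.toEmbedding = z)
      = Fintype.card (ZMod n ≃ β) := by
  have hfib := card_eq_sum_card_fiberwise (f := fun φ : ZMod n ≃ β => x.map φ.toEmbedding) (s := univ)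
    (t := powersetCard #x (univ : Finset β)) (fun φ _ => by
      rw [mem_coe, mem_powersetCard]; exact ⟨subset_univ _, card_map _⟩)
  rw [card_univ] at hfib
  rw [hfib, ← Finset.card_univ, ← card_powersetCard #x (univ : Finset β), ← smul_eq_mul, ← sum_const]
  refine sum_congr rfl fun w hw => ?_
  rw [mem_powersetCard] at hw
  exact card_filter_map_eq_eq x (hz.trans hw.2.symm)

/-- Averaging identity: `C(#β, #x) · Σ_φ [x.map φ ∈ F] = #(ZMod n ≃ β) · #{z ∈ F : #z = #x}`. [this work] -/
theorem choose_mul_sum_indicator (x : Finset (ZMod n)) (F : Finset (Finset β)) :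
    (Fintype.card β).choose #x * ∑ φ : ZMod n ≃ β, (if x.map φ.toEmbedding ∈ F then 1 else 0)
      = Fintype.card (ZMod n ≃ β) * #(F.filter fun z => #z = #x) := by
  have h1 : ∀ φ : ZMod n ≃ β, (if x.map φ.toEmbedding ∈ F then 1 else 0)
      = ∑ z ∈ F, (if x.map φ.toEmbedding = z then 1 else 0) := by
    intro φ; rw [sum_ite_eq]
  rw [sum_congr rfl fun φ _ => h1 φ, sum_comm, mul_sum, card_eq_sum_ones (F.filter _), sum_filter, mul_sum]
  refine sum_congr rfl fun z _ => ?_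
  rw [sum_boole, Nat.cast_id]
  by_cases hz : #z = #x
  · rw [if_pos hz, mul_one, choose_mul_card_filter_map_eq x z hz]
  · rw [if_neg hz, mul_zero]
    have : (univ.filter fun φ : ZMod n ≃ β => x.map φ.toEmbedding = z) = ∅ := by
      rw [filter_eq_empty_iff]
      intro φ _ h
      exact hz (by rw [← h, card_map])
    rw [this, card_empty, mul_zero]

/-- Averaged arc counts: `C(n,j) · Σ_φ #{s : (arc s j).map φ ∈ F} = n · #(ZMod n ≃ β) · #F_j` (`#β = n`, `j ≤ n`). [this work] -/
theorem choose_mul_sum_card_arcStarts (hβ : Fintype.card β = n) (F : Finset (Finset β)) {j : ℕ} (hj : j ≤ n) :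
    n.choose j * ∑ φ : ZMod n ≃ β,
        #(univ.filter fun s : ZMod n => ((range j).image fun i : ℕ => s + (i : ZMod n)).map φ.toEmbedding ∈ F)
      = n * (Fintype.card (ZMod n ≃ β) * #(F.filter fun z => #z = j)) := by
  have h1 : ∀ φ : ZMod n ≃ β,
      #(univ.filter fun s : ZMod n => ((range j).image fun i : ℕ => s + (i : ZMod n)).map φ.toEmbedding ∈ F)
        = ∑ s : ZMod n, (if ((range j).image fun i : ℕ => s + (i : ZMod n)).map φ.toEmbedding ∈ F then 1 else 0) := by
    intro φ; rw [sum_boole, Nat.cast_id]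
  rw [sum_congr rfl fun φ _ => h1 φ, sum_comm, mul_sum]
  have h2 : ∀ s : ZMod n, n.choose j * ∑ φ : ZMod n ≃ β,
      (if ((range j).image fun i : ℕ => s + (i : ZMod n)).map φ.toEmbedding ∈ F then 1 else 0)
        = Fintype.card (ZMod n ≃ β) * #(F.filter fun z => #z = j) := by
    intro s
    have := choose_mul_sum_indicator ((range j).image fun i : ℕ => s + (i : ZMod n)) F
    rwa [card_arc s hj, hβ] at this
  rw [sum_congr rfl fun s _ => h2 s, sum_const, card_univ, ZMod.card, smul_eq_mul]

omit [Fintype β] in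
/-- The pulled-back family `{x : x.map φ ∈ F}` of a lower set is a lower set. [this work] -/
theorem isLowerSet_pullback (F : Finset (Finset β)) (hF : IsLowerSet (F : Set (Finset β))) (φ : ZMod n ≃ β) :
    IsLowerSet (((univ : Finset (Finset (ZMod n))).filter fun x => x.map φ.toEmbedding ∈ F : Finset (Finset (ZMod n))) :
      Set (Finset (ZMod n))) := by
  intro x y hyx hx
  rw [mem_coe, mem_filter] at hx ⊢
  exact ⟨mem_univ _, hF (map_subset_map.2 hyx) hx.2⟩

/-- … and no two of its members cover everything if no two members of `F` do. [this work] -/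
theorem pullback_union_ne_univ (F : Finset (Finset β)) (hFF : ∀ z ∈ F, ∀ w ∈ F, z ∪ w ≠ univ) (φ : ZMod n ≃ β)
    {x y : Finset (ZMod n)} (hx : x ∈ (univ : Finset (Finset (ZMod n))).filter fun x => x.map φ.toEmbedding ∈ F)
    (hy : y ∈ (univ : Finset (Finset (ZMod n))).filter fun x => x.map φ.toEmbedding ∈ F) : x ∪ y ≠ univ := by
  intro hxy
  rw [mem_filter] at hx hy
  apply hFF _ hx.2 _ hy.2
  rw [← map_union, hxy, map_univ_equiv]

omit [DecidableEq β] [Fintype β] [NeZero n] in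
/-- Level bookkeeping: `Σ_{a ≤ j < b} #{z ∈ F : #z = j} = #{z ∈ F : a ≤ #z < b}`. [folklore] -/
theorem sum_card_level_eq (F : Finset (Finset β)) (a b : ℕ) :
    ∑ j ∈ Ico a b, #(F.filter fun z => #z = j) = #(F.filter fun z => a ≤ #z ∧ #z < b) := by
  rw [card_eq_sum_card_fiberwise (f := fun z : Finset β => #z) (s := F.filter fun z => a ≤ #z ∧ #z < b) (t := Ico a b)
    (fun z hz => by rw [mem_coe, mem_filter] at hz; rw [mem_coe, mem_Ico]; exact hz.2)]
  refine sum_congr rfl fun j hj => ?_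
  rw [mem_Ico] at hj
  congr 1
  ext z
  simp only [mem_filter]
  constructor
  · rintro ⟨hz, rfl⟩; exact ⟨⟨hz, hj⟩, rfl⟩
  · rintro ⟨⟨hz, _⟩, rfl⟩; exact ⟨hz, rfl⟩

/-- **Half-cube lemma** (memo Lemma C), whole-type form: a lower set of subsets of a type of size `2m`, no two members of which
cover the type, has at most as many members of size `≥ m` as members of size `< m`. [this work] -/
theorem halfCube_univ {m : ℕ} (hβ : Fintype.card β = 2 * m) (F : Finset (Finset β)) (hF : IsLowerSet (F : Set (Finset β)))
    (hFF : ∀ z ∈ F, ∀ w ∈ F, z ∪ w ≠ univ) : #(F.filter fun z => m ≤ #z) ≤ #(F.filter fun z => #z < m) := by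
  -- every member is a proper subset
  have hlt : ∀ z ∈ F, #z < 2 * m := by
    intro z hz
    have hne : z ≠ univ := fun h => hFF z hz z hz (by rw [h, union_self])
    rw [← hβ, ← card_univ]
    exact card_lt_card (ssubset_of_subset_of_ne (subset_univ z) hne)
  rcases Nat.eq_zero_or_pos m with rfl | hm
  · -- no members at all
    have : F.filter (fun z => 0 ≤ #z) = ∅ := by
      rw [filter_eq_empty_iff]; intro z hz; have := hlt z hz; omega
    rw [this, card_empty]; exact Nat.zero_le _
  rcases F.eq_empty_or_nonempty with rfl | hFne
  · simp
  -- the circle `ZMod (2m)`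
  haveI : NeZero (2 * m) := ⟨by omega⟩
  have hempty : (∅ : Finset β) ∈ F := by
    obtain ⟨z, hz⟩ := hFne; exact hF (empty_subset z) hz
  -- per-bijection arc inequality, summed
  have hper : ∀ φ : ZMod (2 * m) ≃ β,
      ∑ j ∈ Ico m (2 * m), (((2 * m).choose j : ℤ) *
          (#(univ.filter fun s : ZMod (2 * m) =>
            ((range j).image fun i : ℕ => s + (i : ZMod (2 * m))).map φ.toEmbedding ∈ F) : ℤ))
        ≤ 2 * (m : ℤ) + ∑ j ∈ Ico 1 m, (((2 * m).choose j : ℤ) *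
          (#(univ.filter fun s : ZMod (2 * m) =>
            ((range j).image fun i : ℕ => s + (i : ZMod (2 * m))).map φ.toEmbedding ∈ F) : ℤ)) := by
    intro φ
    have h := arc_ineq_family ((univ : Finset (Finset (ZMod (2 * m)))).filter fun x => x.map φ.toEmbedding ∈ F) hm rfl
      (isLowerSet_pullback F hF φ) (fun x hx y hy => pullback_union_ne_univ F hFF φ hx hy)
    have hrw : ∀ j : ℕ, (univ.filter fun s : ZMod (2 * m) => ((range j).image fun i : ℕ => s + (i : ZMod (2 * m)))
          ∈ (univ : Finset (Finset (ZMod (2 * m)))).filter fun x => x.map φ.toEmbedding ∈ F)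
        = univ.filter fun s : ZMod (2 * m) => ((range j).image fun i : ℕ => s + (i : ZMod (2 * m))).map φ.toEmbedding ∈ F := by
      intro j; ext s; simp only [mem_filter, mem_univ, true_and]
    simp only [hrw] at h
    exact h
  have hsum := sum_le_sum fun φ (_ : φ ∈ (univ : Finset (ZMod (2 * m) ≃ β))) => hper φ
  -- evaluate the averaged arc counts level by level
  have hlev : ∀ j ∈ Ico 1 (2 * m), ∑ φ : ZMod (2 * m) ≃ β, (((2 * m).choose j : ℤ) *
        (#(univ.filter fun s : ZMod (2 * m) =>
          ((range j).image fun i : ℕ => s + (i : ZMod (2 * m))).map φ.toEmbedding ∈ F) : ℤ))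
      = 2 * (m : ℤ) * (Fintype.card (ZMod (2 * m) ≃ β) : ℤ) * #(F.filter fun z => #z = j) := by
    intro j hj
    rw [mem_Ico] at hj
    rw [← mul_sum]
    have := choose_mul_sum_card_arcStarts (n := 2 * m) hβ F (le_of_lt hj.2)
    have := congrArg (fun x : ℕ => (x : ℤ)) this
    push_cast at this ⊢
    linarith
  have hL : ∑ φ : ZMod (2 * m) ≃ β, ∑ j ∈ Ico m (2 * m), (((2 * m).choose j : ℤ) *
        (#(univ.filter fun s : ZMod (2 * m) =>
          ((range j).image fun i : ℕ => s + (i : ZMod (2 * m))).map φ.toEmbedding ∈ F) : ℤ))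
      = 2 * (m : ℤ) * (Fintype.card (ZMod (2 * m) ≃ β) : ℤ) * ∑ j ∈ Ico m (2 * m), (#(F.filter fun z => #z = j) : ℤ) := by
    rw [sum_comm, mul_sum]
    exact sum_congr rfl fun j hj => hlev j (by rw [mem_Ico] at hj ⊢; omega)
  have hR : ∑ φ : ZMod (2 * m) ≃ β, (2 * (m : ℤ) + ∑ j ∈ Ico 1 m, (((2 * m).choose j : ℤ) *
        (#(univ.filter fun s : ZMod (2 * m) =>
          ((range j).image fun i : ℕ => s + (i : ZMod (2 * m))).map φ.toEmbedding ∈ F) : ℤ)))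
      = (Fintype.card (ZMod (2 * m) ≃ β) : ℤ) * (2 * (m : ℤ))
        + 2 * (m : ℤ) * (Fintype.card (ZMod (2 * m) ≃ β) : ℤ) * ∑ j ∈ Ico 1 m, (#(F.filter fun z => #z = j) : ℤ) := by
    rw [sum_add_distrib, sum_const, card_univ, nsmul_eq_mul, sum_comm, mul_sum]
    congr 1
    exact sum_congr rfl fun j hj => hlev j (by rw [mem_Ico] at hj ⊢; omega)
  rw [hL, hR] at hsum
  -- cancel the positive factor `2m · #(bijections)`
  have hP : 0 < (Fintype.card (ZMod (2 * m) ≃ β) : ℤ) := by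
    have : Nonempty (ZMod (2 * m) ≃ β) := ⟨Fintype.equivOfCardEq (by rw [ZMod.card, hβ])⟩
    exact_mod_cast Fintype.card_pos
  have hkey : (∑ j ∈ Ico m (2 * m), (#(F.filter fun z => #z = j) : ℤ))
      ≤ 1 + ∑ j ∈ Ico 1 m, (#(F.filter fun z => #z = j) : ℤ) := by
    have hm' : (0 : ℤ) < 2 * (m : ℤ) * (Fintype.card (ZMod (2 * m) ≃ β) : ℤ) := by positivity
    refine le_of_mul_le_mul_left ?_ hm'
    linarith
  -- translate level sums into the two counts
  have hhi : (#(F.filter fun z => m ≤ #z) : ℤ) = ∑ j ∈ Ico m (2 * m), (#(F.filter fun z => #z = j) : ℤ) := by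
    rw [← Nat.cast_sum, sum_card_level_eq]
    congr 2; ext z; simp only [mem_filter]
    exact ⟨fun h => ⟨h.1, h.2, hlt z h.1⟩, fun h => ⟨h.1, h.2.1⟩⟩
  have hlo : (#(F.filter fun z => #z < m) : ℤ) = 1 + ∑ j ∈ Ico 1 m, (#(F.filter fun z => #z = j) : ℤ) := by
    rw [← Nat.cast_sum, sum_card_level_eq]
    have hsplit : F.filter (fun z => #z < m) = {∅} ∪ F.filter (fun z => 1 ≤ #z ∧ #z < m) := by
      ext z; simp only [mem_filter, mem_union, mem_singleton]
      constructor
      · rintro ⟨hz, h⟩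
        by_cases h0 : z = ∅
        · exact Or.inl h0
        · exact Or.inr ⟨hz, by rw [Nat.one_le_iff_ne_zero]; exact fun h' => h0 (card_eq_zero.1 h'), h⟩
      · rintro (rfl | ⟨hz, _, h⟩)
        · exact ⟨hempty, by rw [card_empty]; exact hm⟩
        · exact ⟨hz, h⟩
    rw [hsplit, card_union_of_disjoint, card_singleton]
    · push_cast; ring
    · rw [disjoint_singleton_left, mem_filter, card_empty]; omega
  rw [← Nat.cast_le (α := ℤ), hhi, hlo]
  exact hkey

end Averaging

/-! ### Transport to a ground finset inside an arbitrary type, and the unconditional (RAB_k) -/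

section Transport

variable {α : Type*} [DecidableEq α]

/-- **Half-cube lemma** (memo Lemma C) for families inside a ground finset `t` with `#t = 2m`: a lower set `F ⊆ 𝒫(t)` no two
members of which cover `t` satisfies `#{z ∈ F : m ≤ #z} ≤ #{z ∈ F : #z < m}`.  This is exactly hypothesis `hC` of
`rab_of_halfCube`. [this work] -/
theorem halfCube (t : Finset α) (m : ℕ) (F : Finset (Finset α)) (ht : #t = 2 * m) (hF : IsLowerSet (F : Set (Finset α)))
    (hFt : ∀ u ∈ F, u ⊆ t) (hFF : ∀ z ∈ F, ∀ w ∈ F, z ∪ w ≠ t) :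
    #(F.filter fun z => m ≤ #z) ≤ #(F.filter fun z => #z < m) := by
  -- move to the subtype `{x // x ∈ t}`
  set f : Finset α → Finset {x // x ∈ t} := fun z => z.subtype (· ∈ t) with hf
  have hback : ∀ z, z ⊆ t → (f z).map (Function.Embedding.subtype _) = z := fun z hz =>
    subtype_map_of_mem fun x hx => hz hx
  have hcard : ∀ z, z ⊆ t → #(f z) = #z := by
    intro z hz; rw [← card_map (Function.Embedding.subtype _), hback z hz]
  have hinj : Set.InjOn f F := by
    intro z hz w hw h
    rw [← hback z (hFt z hz), ← hback w (hFt w hw)]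
    exact congrArg _ h
  set F' := F.image f with hF'
  have hF'low : IsLowerSet (F' : Set (Finset {x // x ∈ t})) := by
    intro y y' hy' hy
    rw [mem_coe, hF', mem_image] at hy ⊢
    obtain ⟨z, hz, rfl⟩ := hy
    refine ⟨y'.map (Function.Embedding.subtype _), hF ?_ hz, ?_⟩
    · show y'.map (Function.Embedding.subtype _) ≤ z
      rw [← hback z (hFt z hz)]; exact map_subset_map.2 hy'
    · ext b; simp only [hf, mem_subtype, mem_map, Function.Embedding.coe_subtype]
      constructor
      · rintro ⟨b', hb', h⟩; rwa [← Subtype.ext h]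
      · intro hb; exact ⟨b, hb, rfl⟩
  have hF'cov : ∀ y ∈ F', ∀ y' ∈ F', y ∪ y' ≠ univ := by
    intro y hy y' hy' h
    rw [hF', mem_image] at hy hy'
    obtain ⟨z, hz, rfl⟩ := hy
    obtain ⟨w, hw, rfl⟩ := hy'
    apply hFF z hz w hw
    have := congrArg (Finset.map (Function.Embedding.subtype (· ∈ t))) h
    rwa [map_union, hback z (hFt z hz), hback w (hFt w hw), univ_eq_attach, attach_map_val] at this
  have hβ : Fintype.card {x // x ∈ t} = 2 * m := by rw [Fintype.card_coe, ht]
  have key := halfCube_univ hβ F' hF'low hF'cov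
  have hcount : ∀ p : ℕ → Prop, ∀ [DecidablePred p],
      #(F'.filter fun y => p #y) = #(F.filter fun z => p #z) := by
    intro p _
    rw [hF', filter_image, card_image_of_injOn (fun z hz w hw h => hinj (mem_filter.1 hz).1 (mem_filter.1 hw).1 h)]
    congr 1; ext z; simp only [mem_filter]
    exact ⟨fun ⟨hz, h⟩ => ⟨hz, by rwa [hcard z (hFt z hz)] at h⟩, fun ⟨hz, h⟩ => ⟨hz, by rwa [hcard z (hFt z hz)]⟩⟩
  rw [hcount (fun c => m ≤ c), hcount (fun c => c < m)] at key
  exact key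

/-- **(RAB_k) for every `k`, unconditionally** (memo Theorem 1, down-set counting form).  For lower sets `D, E ⊆ 𝒫(s)`,
`y = #s ≥ 2k − 2`, cross pairs `X = {z ∈ D : s \ z ∈ E}`:
`#{z ∈ X : k ≤ #z} + #{z ∈ X : #z + k ≤ y} + #{v ∈ D∩E : y < #v + k} ≤ #X + #{v ∈ D∩E : #v + k ≤ y}`.
In the up-set language of the memo (`u = s \ v`): `#{u ∈ A∩B : #u ≥ k} − #{u ∈ A∩B : #u < k} ≥ Σ_{z ∈ A, s\z ∈ B}([#z ≥ k] + [y−#z ≥ k] − 1)`,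
gen-17's conjectured fibre lemma, for all `k`. [this work] -/
theorem rab_counting (s : Finset α) (k : ℕ) (D E : Finset (Finset α)) (hD : IsLowerSet (D : Set (Finset α)))
    (hE : IsLowerSet (E : Set (Finset α))) (hDs : ∀ t ∈ D, t ⊆ s) (hEs : ∀ t ∈ E, t ⊆ s) (hk : 2 * k ≤ #s + 2) :
    #((D.filter fun z => s \ z ∈ E).filter fun z => k ≤ #z)
        + #((D.filter fun z => s \ z ∈ E).filter fun z => #z + k ≤ #s)
        + #((D ∩ E).filter fun v => #s < #v + k)
      ≤ #(D.filter fun z => s \ z ∈ E) + #((D ∩ E).filter fun v => #v + k ≤ #s) :=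
  rab_counting_of_halfCube (fun t m F ht hF hFt hFF => halfCube t m F ht hF hFt hFF) s k D E hD hE hDs hEs hk

/-- **(RAB_k) for every `k`, unconditionally**, integer-sum form (memo Theorem 1). [this work] -/
theorem rab (s : Finset α) (k : ℕ) (D E : Finset (Finset α)) (hD : IsLowerSet (D : Set (Finset α)))
    (hE : IsLowerSet (E : Set (Finset α))) (hDs : ∀ t ∈ D, t ⊆ s) (hEs : ∀ t ∈ E, t ⊆ s) (hk : 2 * k ≤ #s + 2) :
    0 ≤ (∑ v ∈ D ∩ E, (if #v + k ≤ #s then (1 : ℤ) else -1))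
          - ∑ z ∈ D with s \ z ∈ E, ((if k ≤ #z then 1 else 0) + (if #z + k ≤ #s then 1 else 0) - 1 : ℤ) :=
  rab_of_halfCube (fun t m F ht hF hFt hFF => halfCube t m F ht hF hFt hFF) s k D E hD hE hDs hEs hk

end Transport

end Summit.CriticalPhenomena.PercolationContinuityZ3.Theorems.ThresholdRAB
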